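import Summits.RiemannHypothesis.RiemannHypothesis.Theorems.WeilTwoPrimeDeflM80PBase
import Summits.RiemannHypothesis.RiemannHypothesis.Theorems.WeilTwoPrimeDeflM80PDataPE33
import Summits.RiemannHypothesis.RiemannHypothesis.Theorems.WeilTwoPrimeDeflM80PDataDnE18
import Literature.NumberTheory.LFunctions.WeilBlockRowsPZ
import Literature.NumberTheory.LFunctions.WeilBlockRowsFast
import HarnessLib

/-!
# Even-sector deflated two-prime certificate M80P: dominance of row 51 of `R = S''_even(κ') − UᵀU` (factored data)

`WeilCert.checkDomRowF` (linear-traversal form) with the materialized augmented block, the factored inverse `weilCertDeflM80PDnE/weilCertDeflM80PLsE` and the Bessel block, by `decide +kernel`, then `WeilCert.checkDomRowPZ_of_F`. Pure proof file.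
-/

set_option linter.dupNamespace false

noncomputable section

namespace Summit.RiemannHypothesis.RiemannHypothesis.Theorems.EvenWinsBeyondArch

open Literature.NumberTheory.LFunctions

set_option maxHeartbeats 0 in
/-- Kernel check of the dominance of row 51 of `R` (even block, certificate M80P). [folklore] -/
theorem checkDomRowF0_51_weilCertDeflM80P :
    weilCertDeflM80PBase.checkDomRowF weilCertDeflM80PPmE weilCertDeflM80PDnE weilCertDeflM80PLsE weilCertDeflM80PHpE weilCertDeflM80PKappa' 0 51 = true := by
  decide +kernel

/-- Kernel check of the dominance of row 51 of `R` (factored data), from the fast row. [folklore] -/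
theorem checkDomRowPZ0_51_weilCertDeflM80P :
    weilCertDeflM80PBase.checkDomRowPZ weilCertDeflM80PPmE weilCertDeflM80PDnE weilCertDeflM80PLsE weilCertDeflM80PHpE weilCertDeflM80PKappa' 0 51 = true :=
  WeilCert.checkDomRowPZ_of_F (by decide) checkDomRowF0_51_weilCertDeflM80P


end Summit.RiemannHypothesis.RiemannHypothesis.Theorems.EvenWinsBeyondArch
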